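import Mathlib
import HarnessLib
import Summits.NavierStokesRegularity.NavierStokesRegularity.Theorems.ChiralWindowDoorDefs
import Summits.NavierStokesRegularity.NavierStokesRegularity.Theorems.ChiralWindowDoorBinderFree
import Summits.NavierStokesRegularity.NavierStokesRegularity.Theorems.ChiralWindowDoorSobolevFatou

/-!
# Door family S20/S21-C — the fractional-Sobolev stub (S20 B5a = S21-C F4) in BINDER-FREE class form

Door S20 «ChiralWindowDoor» / S21-C «CriticalFluxDoor» of nsreg-p1's local Type-I door family (DESIGN-ONLY, routes NOT
born).  Both lines carry the stub «uniform windowed Gagliardo bound ⇒ uniform `L³(B₁)` bound» (S20 `stub_sobolevFatou` =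
B5a, S21-C `stub_sobolevFatou` = F4); the binder-free S21-C/Sketch20v6 texts state it with the Type-I rate, the Type-I
decay and continuity ONLY — which is not provable (junk-value witness, see `…ChiralWindowDoorSobolevFatou`).  The form
the compositions can actually use is the CLASS form; here it is without the R19 binder:

* `sobolevFatou_of_class_noBinder` — door class (rate, decay, continuity on the open slab, unit-viscosity Oseen–Duhamel
  identity, divergence-free slices) + `gagliardo (bumpSq η R) (v t₀) ≤ c` uniformly ⇒ `∃ M, ∀ t ∈ (−1,0), ∫⁻_{B₁}‖v t‖ₑ³ ≤ M`
  (`…SobolevFatou.sobolevFatou_of_class` + the binder from the class, `…BinderFree.exists_hasTypeIDerivDecay_of_class`).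

Seat nsreg-p6 g12 (THEOREMS-ONLY door sequels, DIRECTOR-NS g8 #32 (2)/#36).  WHAT THIS IS NOT: not NS regularity
(Clay A); bookkeeping; no route is opened.  → nsreg-p1: state F4/B5a with the class hypotheses (this signature).
-/

noncomputable section

-- the summit and its single sub-problem share the name (CONVENTIONS §1), as in every Theorems file
set_option linter.dupNamespace false

namespace Summit.NavierStokesRegularity.NavierStokesRegularity.Theorems.ChiralWindowDoorSobolevFatouOfClass

open MeasureTheory Set Function Filter Topology Metric
open scoped RealInnerProductSpace ENNReal NNReal
open Literature.Analysis Literature.Analysis.FluidPDE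
open Summit.NavierStokesRegularity.NavierStokesRegularity.Theorems.ChiralWindowDoorDefs
open Summit.NavierStokesRegularity.NavierStokesRegularity.Theorems.ChiralWindowDoorBinderFree
  (exists_hasTypeIDerivDecay_of_class)
open Summit.NavierStokesRegularity.NavierStokesRegularity.Theorems.ChiralWindowDoorSobolevFatou (sobolevFatou_of_class)

/-- **S20 B5a = S21-C F4 in binder-free CLASS form**: for a door-class profile, a uniform bound on the windowed Gagliardo
forms of the slices gives a uniform `L³(B₁)` bound on `t ∈ (−1,0)`. -/
theorem sobolevFatou_of_class_noBinder : ∀ (η : EuclideanSpace ℝ (Fin 3) → ℝ), IsAdmissibleBump η → ∀ (C D : ℝ)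
    (v : ℝ → EuclideanSpace ℝ (Fin 3) → EuclideanSpace ℝ (Fin 3)),
    HasTypeITimeDecay C v → HasTypeIDecay D v →
    ContinuousOn (Function.uncurry v) (Set.Iio (0 : ℝ) ×ˢ Set.univ) →
    (∀ s t : ℝ, s < t → t < 0 → ∀ x,
        v t x = UnboundedOperators.heatExtension (v s) (t - s) x - oseenDuhamel 1 s v v t x) →
    (∀ t < 0, VectorCalculus.IsDivFree (v t)) →
    (∃ c : ℝ, ∀ R > (0 : ℝ), ∀ t₀ < (0 : ℝ), gagliardo (bumpSq η R) (v t₀) ≤ c) →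
    ∃ M : NNReal, ∀ t ∈ Set.Ioo (-1 : ℝ) 0,
      ∫⁻ x in Metric.ball (0 : EuclideanSpace ℝ (Fin 3)) 1, ‖v t x‖ₑ ^ (3 : ℕ) ≤ M := by
  intro η hη C D v hrate hdecay hcont hmild hdiv hG
  obtain ⟨K, hK⟩ := exists_hasTypeIDerivDecay_of_class hrate hdecay hcont hmild hdiv
  exact sobolevFatou_of_class η hη C D K v hrate hdecay hK hcont hmild hG

end Summit.NavierStokesRegularity.NavierStokesRegularity.Theorems.ChiralWindowDoorSobolevFatouOfClass

end
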